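import Literature.AlgebraicGeometry.Motives.FaltingsAbelianBaseChangeDescent
import Literature.AlgebraicGeometry.Motives.FaltingsTateBiprodAdditivity
import Literature.AlgebraicGeometry.Motives.AbelianVarietyBaseChangeFaithful
import HarnessLib

/-!
# [Faltings 1983, §5 Kor. 1] for pairs which become isogenous over a finite normal extension

Theorems only (topic `AlgebraicGeometry/Motives`; no definition, no named fact, no instance; net
Literature debt 0).  Cell `hodgecm-mathlib` (D-0151), T5 distance ledger of the binder `hFal`
(row VI-1 of `stmt-HodgeConjecture-24832`), item (O-N8): the GENERIC half of the «twist family».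

THE STATEMENT (`faltings_tate_bijective_of_isIsogenous_baseChange`).  Let `K ⊆ E` be number fields with
`E/K` finite and normal, and let `A, A′` be abelian varieties over `K` whose base changes `A ⊗_K E`,
`A′ ⊗_K E` are `E`-isogenous.  If the Tate map `ℤ_ℓ ⊗ End_E(A ⊗ E) → End_{Γ_E}(T_ℓ(A ⊗ E))` is
bijective (`faltings_tate_bijective (A.baseChange E) (A.baseChange E) ℓ`, the `End` form of
[Fal83 §5 Satz 4] for ONE of the two varieties up there), then the Tate map is bijective for each of
the pairs `(A, A′)`, `(A′, A)`, `(A′, A′)` over `K` — the TEXT of [Fal83 §5 Kor. 1] for a pair of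
`K`-forms («twists») of potentially isogenous varieties.

THE PROOF is Faltings' own reduction, every arrow a theorem of the tree:
«Wir dürfen `K` durch eine endliche Erweiterung ersetzen» — base-change descent along the finite normal
`E/K` in the `End` form (★ `faltings_tate_bijective_of_baseChange_end`, `FaltingsAbelianBaseChangeDescent`),
applied to `P = A ⊞ A′`; Korollar 1 ⇐ Satz 4 through `A ⊞ A′` (★ `faltings_tate_bijective_of_end_biprod`,
`FaltingsAbelianProofs`); over `E`, `(A ⊞ A′) ⊗ E ≅ (A ⊗ E) ⊞ (A′ ⊗ E)` (base change is an additive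
functor, ★ `(baseChangeFunctor K E).Additive`; §1) and all four pairs of summands are isogenous to
`(A ⊗ E, A ⊗ E)`, so the `End` statement for the square follows from the hypothesis by isogeny
invariance (★ `faltings_tate_bijective_of_isIsogenous`, [Fal83 §5 proof of Satz 4, first sentence]) and
additivity over biproducts (★ `faltings_tate_bijective_biprod_biprod`).

* §1 `nonempty_baseChange_biprod_iso`, `isIsogenous_baseChange_biprod` — `(A ⊞ A′) ⊗ E ≅ (A ⊗ E) ⊞ (A′ ⊗ E)`
  (binary twin of `nonempty_baseChange_biproduct_iso` of `ComplexMultiplication/CMStructureIsogenousPrimitivePower`).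
* §2 `faltings_tate_bijective_biprod_of_isIsogenous` — the `End` statement for `X ⊞ Y` from the one for
  `X` when `X ∼ Y`.
* §3 `faltings_tate_bijective_of_isIsogenous_baseChange` (the statement above) and its `End`-only
  corollary `faltings_tate_bijective_end_of_isIsogenous_baseChange` (`A′` alone).

Consumers: `NumberTheory/ComplexMultiplication/FaltingsTateOfCMTwists` (two CM structures of one type
are geometrically isogenous; `A ⊗ E` has the `End` statement by ★ `FaltingsTateOfPrimitiveCM` /
★ `FaltingsTateOfCMElliptic`).

## References

* [Faltings1983Endlichkeit] G. Faltings, *Endlichkeitssätze für abelsche Varietäten über Zahlkörpern*,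
  Invent. Math. 73 (1983), §5: proof of Satz 4 (p. 360, «endliche Erweiterung»), Korollar 1 (p. 361).
* [Milne1986AbelianVarieties] J. S. Milne, *Abelian Varieties* (Cornell–Silverman 1986), §16 and proof of
  Thm. 12.5 (reduction to `End`, passage to a finite extension).
* [MumfordAV1970] D. Mumford, *Abelian Varieties* (1970), §19 Thm. 3 (p. 176).
-/

noncomputable section

universe u

open CategoryTheory CategoryTheory.Limits

namespace Literature.AlgebraicGeometry.Motives

namespace AbelianVariety

/-! ## §1 Base change commutes with the binary biproduct -/

section Biprod

variable {K : Type u} [Field K] (E : Type u) [Field E] [Algebra K E]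

/-- **`(A ⊞ A′) ⊗_K E ≅ (A ⊗_K E) ⊞ (A′ ⊗_K E)`**: base change of abelian varieties is an additive functor
(★ `(baseChangeFunctor K E).Additive`), hence commutes with binary biproducts; the isomorphism is
`⟨(fst) ⊗ E, (snd) ⊗ E⟩` with inverse `[(inl) ⊗ E, (inr) ⊗ E]`. [cite: MumfordAV1970, §19 (p. 176)] -/
theorem nonempty_baseChange_biprod_iso (A A' : AbelianVariety K) :
    Nonempty ((A ⊞ A').baseChange E ≅ A.baseChange E ⊞ A'.baseChange E) := by
  refine ⟨{ hom := biprod.lift (Hom.baseChange E (biprod.fst : A ⊞ A' ⟶ A)) (Hom.baseChange E biprod.snd)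
            inv := biprod.desc (Hom.baseChange E (biprod.inl : A ⟶ A ⊞ A')) (Hom.baseChange E biprod.inr)
            hom_inv_id := ?_
            inv_hom_id := ?_ }⟩
  · rw [biprod.lift_desc, ← Hom.baseChange_comp, ← Hom.baseChange_comp, ← Hom.baseChange_add,
      biprod.total, Hom.baseChange_id]
  · apply biprod.hom_ext' <;> apply biprod.hom_ext <;>
      simp only [biprod.inl_desc_assoc, biprod.inr_desc_assoc, Category.assoc, biprod.lift_fst,
        biprod.lift_snd, Category.id_comp, biprod.inl_fst, biprod.inl_snd, biprod.inr_fst,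
        biprod.inr_snd, ← Hom.baseChange_comp, Hom.baseChange_id, Hom.baseChange_zero]

/-- **`(A ⊗ E) ⊞ (A′ ⊗ E)` and `(A ⊞ A′) ⊗ E` are isogenous** (they are isomorphic,
`nonempty_baseChange_biprod_iso`; an isomorphism is an isogeny, ★ `IsIsogeny.of_iso`). [cite: MumfordAV1970, §19 (p. 176)] -/
theorem isIsogenous_baseChange_biprod (A A' : AbelianVariety K) :
    IsIsogenous (A.baseChange E ⊞ A'.baseChange E) ((A ⊞ A').baseChange E) := by
  obtain ⟨e⟩ := nonempty_baseChange_biprod_iso E A A'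
  exact ⟨e.inv, IsIsogeny.of_iso e.symm⟩

end Biprod

/-! ## §2 The `End` statement for `X ⊞ Y` from the one for `X`, when `X ∼ Y` -/

section Square

variable {E : Type u} [Field E] (ℓ : ℕ) [Fact ℓ.Prime]

/-- **If `X ∼ Y` and `ℤ_ℓ ⊗ End(X) → End_Γ(T_ℓ X)` is bijective, then so is
`ℤ_ℓ ⊗ End(X ⊞ Y) → End_Γ(T_ℓ(X ⊞ Y))`** (over a number field): the four pairs `(X,X)`, `(X,Y)`,
`(Y,X)`, `(Y,Y)` are isogenous to `(X,X)` (★ `faltings_tate_bijective_of_isIsogenous`), and the statement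
is additive over the biproduct (★ `faltings_tate_bijective_biprod_biprod`).
[cite: Faltings1983Endlichkeit, §5 proof of Satz 4 (first sentence) and Korollar 1] -/
theorem faltings_tate_bijective_biprod_of_isIsogenous {X Y : AbelianVariety E} (hXY : IsIsogenous X Y)
    (hX : faltings_tate_bijective X X ℓ) : faltings_tate_bijective (X ⊞ Y) (X ⊞ Y) ℓ :=
  faltings_tate_bijective_biprod_biprod ℓ X Y X Y hX
    (faltings_tate_bijective_of_isIsogenous ℓ (IsIsogenous.refl X) hXY hX)
    (faltings_tate_bijective_of_isIsogenous ℓ hXY (IsIsogenous.refl X) hX)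
    (faltings_tate_bijective_of_isIsogenous ℓ hXY hXY hX)

end Square

/-! ## §3 Descent to a pair of `K`-forms -/

section Descent

variable {K : Type u} [Field K] (E : Type u) [Field E] [NumberField E] [Algebra K E]
  [FiniteDimensional K E] [Normal K E] (ℓ : ℕ) [Fact ℓ.Prime]

/-- **[Fal83 §5 Kor. 1] for a pair of `K`-forms of potentially isogenous abelian varieties.**  Let
`E/K` be a finite normal extension of number fields and `A, A′` abelian varieties over `K` with
`A ⊗_K E ∼ A′ ⊗_K E`.  If `ℤ_ℓ ⊗ End_E(A ⊗ E) → End_{Γ_E}(T_ℓ(A ⊗ E))` is bijective, then the Tate map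
`ℤ_ℓ ⊗ Hom_K(·, ·) → Hom_{Γ_K}(T_ℓ ·, T_ℓ ·)` is bijective for `(A, A′)`, `(A′, A)` and `(A′, A′)`.
Proof: §2 gives the `End` statement for `(A ⊗ E) ⊞ (A′ ⊗ E) ≅ (A ⊞ A′) ⊗ E` (§1), which DESCENDS to
`A ⊞ A′` along `E/K` (★ `faltings_tate_bijective_of_baseChange_end`) and yields the pairs by
★ `faltings_tate_bijective_of_end_biprod` (for `(A′, A)` through the braiding `A ⊞ A′ ≅ A′ ⊞ A`); the
pair `(A′, A′)` is the descent of the `End` statement for `A′ ⊗ E ∼ A ⊗ E`.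
[cite: Faltings1983Endlichkeit, §5 proof of Satz 4 (p. 360) and Korollar 1 (p. 361)]
[cite: Milne1986AbelianVarieties, §16 and proof of Thm. 12.5] -/
theorem faltings_tate_bijective_of_isIsogenous_baseChange {A A' : AbelianVariety K}
    (hiso : IsIsogenous (A.baseChange E) (A'.baseChange E))
    (hA : faltings_tate_bijective (A.baseChange E) (A.baseChange E) ℓ) :
    faltings_tate_bijective A A' ℓ ∧ faltings_tate_bijective A' A ℓ ∧ faltings_tate_bijective A' A' ℓ := by
  -- the `End` statement for `(A ⊞ A') ⊗ E ≅ (A ⊗ E) ⊞ (A' ⊗ E)`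
  have hsq : faltings_tate_bijective ((A ⊞ A').baseChange E) ((A ⊞ A').baseChange E) ℓ :=
    faltings_tate_bijective_of_isIsogenous ℓ (isIsogenous_baseChange_biprod E A A')
      (isIsogenous_baseChange_biprod E A A') (faltings_tate_bijective_biprod_of_isIsogenous ℓ hiso hA)
  -- descend to `K` and read off the pairs
  have hP : faltings_tate_bijective (A ⊞ A') (A ⊞ A') ℓ :=
    faltings_tate_bijective_of_baseChange_end E ℓ (A ⊞ A') hsq
  -- `A ⊞ A' ≅ A' ⊞ A` (braiding; the tree's `isIsogenous_biprod_comm` asks for a perfect base field)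
  have hbr : IsIsogenous (A ⊞ A') (A' ⊞ A) :=
    ⟨(biprod.braiding A A').hom, IsIsogeny.of_iso (biprod.braiding A A')⟩
  have hP' : faltings_tate_bijective (A' ⊞ A) (A' ⊞ A) ℓ := faltings_tate_bijective_of_isIsogenous ℓ hbr hbr hP
  exact ⟨faltings_tate_bijective_of_end_biprod A A' ℓ hP, faltings_tate_bijective_of_end_biprod A' A ℓ hP',
    faltings_tate_bijective_of_baseChange_end E ℓ A'
      (faltings_tate_bijective_of_isIsogenous ℓ hiso hiso hA)⟩

/-- **The `End` form for a `K`-form**: if `A ⊗_K E ∼ A′ ⊗_K E` over a finite normal `E/K` and the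
`End` statement holds for `A ⊗ E`, then `ℤ_ℓ ⊗ End_K(A′) → End_{Γ_K}(T_ℓ A′)` is bijective.
[cite: Faltings1983Endlichkeit, §5 proof of Satz 4 (p. 360)] -/
theorem faltings_tate_bijective_end_of_isIsogenous_baseChange {A A' : AbelianVariety K}
    (hiso : IsIsogenous (A.baseChange E) (A'.baseChange E))
    (hA : faltings_tate_bijective (A.baseChange E) (A.baseChange E) ℓ) :
    faltings_tate_bijective A' A' ℓ :=
  (faltings_tate_bijective_of_isIsogenous_baseChange E ℓ hiso hA).2.2

end Descent

end AbelianVariety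

end Literature.AlgebraicGeometry.Motives

end
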